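import Summits.RiemannHypothesis.RiemannHypothesis.Theorems.PfPersistenceLoewnerAntichain
import HarnessLib

/-!
# PF persistence — the coupling tube inhabits EVERY typed G1 class (pub-rhpf, cand-6 gen 4, part 2)

**HONEST FRAMING. This is a long-odds MECHANISM SEARCH; no RH claims.** RH-free, sign-free bookkeeping continuing
`PfPersistenceLoewnerAntichain` §4. PROVED = kernel-checked here or in the imported tree files.

The open coupling tube `T_s = {d | ∀ w, d_w − ζ_w + s_w·1 ≻ 0}` (slack `s > 0`, bounded below on every bounded height
range, vanishing along heights — e.g. `s_w = 1/(a_w + 1)`) was shown there to be a `G1-cont` member containing `ζ`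
VACUOUSLY and rejecting every declared dial. Here (PROVED):
* §0 (`convex_loewnerAbove`, `isWindowwise_loewnerAbove`, `barrier_schema_iff_of_loewnerAbove_mem`,
  `convex_barrier_schema_iff`, `windowwise_barrier_schema_iff`): the closed coupling criterion `S⁼ = {ζ ≤ d}` is
  convex and window-wise, and for EVERY acceptance class containing `S⁼` the schema-type wall "`S ∈ 𝒞`, `ζ ∈ S`,
  `S` misses the arithmetic negatives `≠ ζ` ⇒ positivity of `ζ`" is equivalent to that positivity (cell ruling A102
  (A2) made kernel; domain `arithDialSpace`, A102 (A1));
* `isWindowwise_tube`, `inG1int_tube`: it is ALSO a member of the step stratum `G1-int` (window-wise, locally constant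
  at `ζ`, non-local at every height, dial-stable);
* `escapesBelowAlong_tube_pDial`, `escapesBelowAlong_tube_shift`, `dialEscape_tube`, `inG1contU_tube`: it satisfies the
  STRICT bounded-height escape clause (`∀ A ∀ᶠ` reading of clause (3), `DialEscape`), hence lies in `G1-contU` — along
  every `p`-dial and along the shift, the dialled datum patched back to `ζ` above height `A` is a member as soon as
  `2|K−1| |w(p)|` (resp. `δ`) is below the slack floor on heights `≤ A` (`dial_form_abs_le`);
* `singleSlot_not_mem_tube(_of_vanishing)`: it rejects EVERY single-slot arithmetic perturbation of `ζ` (table changed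
  at one slot `q₀ ≥ 2`, prime or not, by any `η ≠ 0` of either sign; read at `a = (n+1) log q₀`) — prime dials and
  Beurling-type one-generator fakes are instances;
* headline `exists_mem_all_G1_classes_zeta_excluding_dials`: ONE criterion lies in `G1-cont ∩ G1-contU ∩ G1-int`,
  contains `ζ` (trivially) and rejects every `p`-dial `K ≠ 1`, every down-shift and every single-slot perturbation.
So none of the cell's typed G1 classes, even the strictest, excludes coupling-tier members whose `ζ`-membership is
vacuous: the typing constrains the SHAPE of a criterion and its behaviour along dials, never the information it
carries about `ζ` (cf. the `GapClassG1` header: "RH-strength is decided member-wise, never by the class"). A statement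
about TYPES of criteria; not a separation claim, no numbers, nothing about RH.
-/

set_option linter.dupNamespace false  -- the mandated namespace repeats `RiemannHypothesis`

open Real Finset Matrix Filter Topology

namespace Summit.RiemannHypothesis.RiemannHypothesis.Theorems.PfPersistence

/-! ## §0 The closed coupling criterion `S⁼`: convex, window-wise; the barrier schema for any class containing it -/

/-- PROVED: `S⁼ = {d | ζ ≤ d window-wise}` is CONVEX. [folklore] -/
theorem convex_loewnerAbove :
    Convex ℝ {d : Datum | ∀ win : Window, ∀ v : Fin (win.N + 1) → ℝ,
      v ⬝ᵥ (zetaDatum win *ᵥ v) ≤ v ⬝ᵥ (d win *ᵥ v)} := by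
  intro d hd d' hd' a b ha hb hab win v
  rw [Pi.add_apply, Pi.smul_apply, Pi.smul_apply, Matrix.add_mulVec, Matrix.smul_mulVec, Matrix.smul_mulVec,
    dotProduct_add, dotProduct_smul, dotProduct_smul, smul_eq_mul, smul_eq_mul]
  have h1 := mul_le_mul_of_nonneg_left (hd win v) ha
  have h2 := mul_le_mul_of_nonneg_left (hd' win v) hb
  have h0 : v ⬝ᵥ (zetaDatum win *ᵥ v) = a * (v ⬝ᵥ (zetaDatum win *ᵥ v)) + b * (v ⬝ᵥ (zetaDatum win *ᵥ v)) := by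
    rw [← add_mul, hab, one_mul]
  linarith

/-- PROVED: `S⁼` is WINDOW-WISE (an all-window AND of per-window closed conditions). [folklore] -/
theorem isWindowwise_loewnerAbove :
    IsWindowwise {d : Datum | ∀ win : Window, ∀ v : Fin (win.N + 1) → ℝ,
      v ⬝ᵥ (zetaDatum win *ᵥ v) ≤ v ⬝ᵥ (d win *ᵥ v)} :=
  ⟨fun win => {M | ∀ v : Fin (win.N + 1) → ℝ, v ⬝ᵥ (zetaDatum win *ᵥ v) ≤ v ⬝ᵥ (M *ᵥ v)}, rfl⟩

/-- **PROVED — BARRIER SCHEMA FOR ANY ACCEPTANCE CLASS CONTAINING `S⁼`** (generalises `monotone_barrier_schema_iff`):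
for every class `𝒞` of criteria with `S⁼ ∈ 𝒞`, the schema "every `S ∈ 𝒞` containing `ζ` and missing the
arithmetic negatives `≠ ζ` forces Galerkin Weil positivity of `ζ`" is EQUIVALENT to that positivity — on the domain
`arithDialSpace` such a schema-type wall is of exactly that strength, never weaker. [folklore] -/
theorem barrier_schema_iff_of_loewnerAbove_mem {𝒞 : Set (Set Datum)}
    (h𝒞 : {d : Datum | ∀ win : Window, ∀ v : Fin (win.N + 1) → ℝ,
      v ⬝ᵥ (zetaDatum win *ᵥ v) ≤ v ⬝ᵥ (d win *ᵥ v)} ∈ 𝒞) :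
    (∀ S ∈ 𝒞, zetaDatum ∈ S → (∀ d ∈ arithDialSpace, d ≠ zetaDatum → DetectablyNegative d → d ∉ S) →
        AllWindowsPositive zetaDatum)
      ↔ AllWindowsPositive zetaDatum :=
  ⟨fun h => h _ h𝒞 zeta_mem_loewnerAbove fun _ hd hne _ hmem => hne (loewnerAbove_inter_arith hd hmem),
    fun h _ _ _ _ => h⟩

/-- PROVED: the CONVEX-class barrier schema on `arithDialSpace` is equivalent to positivity of `ζ`. [folklore] -/
theorem convex_barrier_schema_iff :
    (∀ S : Set Datum, Convex ℝ S → zetaDatum ∈ S →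
        (∀ d ∈ arithDialSpace, d ≠ zetaDatum → DetectablyNegative d → d ∉ S) → AllWindowsPositive zetaDatum)
      ↔ AllWindowsPositive zetaDatum :=
  barrier_schema_iff_of_loewnerAbove_mem (𝒞 := {S | Convex ℝ S}) convex_loewnerAbove

/-- PROVED: the WINDOW-WISE-class (all-window AND) barrier schema on `arithDialSpace` is equivalent to positivity
of `ζ`. [folklore] -/
theorem windowwise_barrier_schema_iff :
    (∀ S : Set Datum, IsWindowwise S → zetaDatum ∈ S →
        (∀ d ∈ arithDialSpace, d ≠ zetaDatum → DetectablyNegative d → d ∉ S) → AllWindowsPositive zetaDatum)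
      ↔ AllWindowsPositive zetaDatum :=
  barrier_schema_iff_of_loewnerAbove_mem (𝒞 := {S | IsWindowwise S}) isWindowwise_loewnerAbove

/-! ## §1 The tube is window-wise and lies in G1-int -/

/-- PROVED: the tube is a WINDOW-WISE (product) criterion. [folklore] -/
theorem isWindowwise_tube (s : Window → ℝ) :
    IsWindowwise {d : Datum | ∀ win : Window, WindowStrictlyPositive
      (d win - zetaDatum win + s win • (1 : Matrix (Fin (win.N + 1)) (Fin (win.N + 1)) ℝ))} :=
  ⟨fun win => {M | WindowStrictlyPositive
      (M - zetaDatum win + s win • (1 : Matrix (Fin (win.N + 1)) (Fin (win.N + 1)) ℝ))}, rfl⟩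

/-- **PROVED — G1-int MEMBERSHIP CERTIFICATE:** the tube (slack `s > 0`) is window-wise, locally constant at `ζ`
window-wise (it is window-wise OPEN and contains `ζ`), non-local at every height and dial-stable. [folklore] -/
theorem inG1int_tube {s : Window → ℝ} (hs : ∀ win, 0 < s win) :
    InG1int {d : Datum | ∀ win : Window, WindowStrictlyPositive
      (d win - zetaDatum win + s win • (1 : Matrix (Fin (win.N + 1)) (Fin (win.N + 1)) ℝ))} :=
  ⟨isWindowwise_tube s, (isWindowwiseOpen_tube s).locallyConstantAt (zeta_mem_tube hs),
    nonlocalAtEveryHeight_tube hs, (isWindowwiseOpen_tube s).dialStable⟩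

/-! ## §2 The strict bounded-height escape clause along the declared dials -/

/-- PROVED: the `p`-dial `K` of `ζ` lowers no window form by more than `2|K−1| |w(p)| · vᵀv`. [folklore] -/
theorem zeta_form_sub_pDial_form_le (p : ℕ) (K : ℝ) (win : Window) (v : Fin (win.N + 1) → ℝ) :
    v ⬝ᵥ (zetaDatum win *ᵥ v) - v ⬝ᵥ (pDial p K win *ᵥ v) ≤ 2 * |K - 1| * |zetaWeights p| * (v ⬝ᵥ v) :=
  (le_abs_self _).trans (dial_form_abs_le win.ha p K zetaWeights v)

/-- PROVED: a datum dominating `ζ − c·1` window-wise in the form sense, with `c_w < s_w` everywhere, lies in the tube. [folklore] -/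
theorem mem_tube_of_form_sub_le {s : Window → ℝ} {d : Datum} (c : Window → ℝ) (hcs : ∀ win, c win < s win)
    (hd : ∀ win : Window, ∀ v : Fin (win.N + 1) → ℝ,
      v ⬝ᵥ (zetaDatum win *ᵥ v) - v ⬝ᵥ (d win *ᵥ v) ≤ c win * (v ⬝ᵥ v)) :
    d ∈ {d : Datum | ∀ win : Window, WindowStrictlyPositive
      (d win - zetaDatum win + s win • (1 : Matrix (Fin (win.N + 1)) (Fin (win.N + 1)) ℝ))} := by
  intro win v hv
  have hvv : 0 < v ⬝ᵥ v :=
    lt_of_le_of_ne (dotProduct_self_nonneg_real v) fun h => hv (dotProduct_self_eq_zero.1 h.symm)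
  rw [Matrix.add_mulVec, Matrix.sub_mulVec, dotProduct_add, dotProduct_sub, Matrix.smul_mulVec, Matrix.one_mulVec,
    dotProduct_smul, smul_eq_mul]
  have h1 := hd win v
  have h2 : c win * (v ⬝ᵥ v) < s win * (v ⬝ᵥ v) := mul_lt_mul_of_pos_right (hcs win) hvv
  linarith

/-- PROVED: the datum equal to `d` on heights `≤ A` and to `ζ` above. [folklore] -/
theorem patchBelow_apply_of_le {A : ℝ} {d : Datum} {win : Window} (h : win.a ≤ A) :
    (fun w : Window => if w.a ≤ A then d w else zetaDatum w) win = d win := if_pos h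

/-- **PROVED — ESCAPE BELOW EVERY HEIGHT ALONG EVERY `p`-DIAL:** if the slack is bounded below on every bounded height
range, then for every `A`, for `K` near `1` the `p`-dial `K` agrees below `A` with a tube member (patch it to `ζ` above
`A`). [folklore] -/
theorem escapesBelowAlong_tube_pDial {s : Window → ℝ} (hs : ∀ win, 0 < s win)
    (hsA : ∀ A : ℝ, ∃ m : ℝ, 0 < m ∧ ∀ win : Window, win.a ≤ A → m ≤ s win) (p : ℕ) :
    EscapesBelowAlong {d : Datum | ∀ win : Window, WindowStrictlyPositive
      (d win - zetaDatum win + s win • (1 : Matrix (Fin (win.N + 1)) (Fin (win.N + 1)) ℝ))}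
      (𝓝[≠] (1 : ℝ)) (pDial p) := by
  classical
  intro A
  obtain ⟨m, hm, hmA⟩ := hsA A
  have hg : Tendsto (fun K : ℝ => 2 * |K - 1| * |zetaWeights p|) (𝓝 1) (𝓝 0) := by
    have h := (((tendsto_id (x := 𝓝 (1 : ℝ))).sub_const 1).abs.const_mul 2).mul_const |zetaWeights p|
    simpa using h
  refine ((hg.eventually_lt_const hm).filter_mono nhdsWithin_le_nhds).mono fun K hK => ?_
  refine ⟨fun w => if w.a ≤ A then pDial p K w else zetaDatum w, ?_,
    fun win hwin => by simp only [if_pos (show win.a ≤ A from hwin)]⟩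
  refine mem_tube_of_form_sub_le (fun w => if w.a ≤ A then 2 * |K - 1| * |zetaWeights p| else 0)
    (fun win => ?_) (fun win v => ?_)
  · by_cases h : win.a ≤ A
    · simp only [if_pos h]; exact hK.trans_le (hmA win h)
    · simp only [if_neg h]; exact hs win
  · by_cases h : win.a ≤ A
    · simp only [if_pos h]; exact zeta_form_sub_pDial_form_le p K win v
    · simp only [if_neg h, sub_self, zero_mul, le_refl]

/-- **PROVED — ESCAPE BELOW EVERY HEIGHT ALONG THE SHIFT** `δ → 0`. [folklore] -/
theorem escapesBelowAlong_tube_shift {s : Window → ℝ} (hs : ∀ win, 0 < s win)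
    (hsA : ∀ A : ℝ, ∃ m : ℝ, 0 < m ∧ ∀ win : Window, win.a ≤ A → m ≤ s win) :
    EscapesBelowAlong {d : Datum | ∀ win : Window, WindowStrictlyPositive
      (d win - zetaDatum win + s win • (1 : Matrix (Fin (win.N + 1)) (Fin (win.N + 1)) ℝ))}
      (𝓝[≠] (0 : ℝ)) shiftDial := by
  classical
  intro A
  obtain ⟨m, hm, hmA⟩ := hsA A
  refine ((eventually_lt_nhds hm).filter_mono nhdsWithin_le_nhds).mono fun δ hδ => ?_
  refine ⟨fun w => if w.a ≤ A then shiftDial δ w else zetaDatum w, ?_,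
    fun win hwin => by simp only [if_pos (show win.a ≤ A from hwin)]⟩
  refine mem_tube_of_form_sub_le (fun w => if w.a ≤ A then δ else 0) (fun win => ?_) (fun win v => ?_)
  · by_cases h : win.a ≤ A
    · simp only [if_pos h]; exact hδ.trans_le (hmA win h)
    · simp only [if_neg h]; exact hs win
  · by_cases h : win.a ≤ A
    · simp only [if_pos h]
      rw [shiftDial, shift, Matrix.sub_mulVec, dotProduct_sub, Matrix.smul_mulVec, Matrix.one_mulVec,
        dotProduct_smul, smul_eq_mul]
      linarith
    · simp only [if_neg h, sub_self, zero_mul, le_refl]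

/-- **PROVED — THE STRICT CLAUSE (3):** the tube satisfies `DialEscape`. [folklore] -/
theorem dialEscape_tube {s : Window → ℝ} (hs : ∀ win, 0 < s win)
    (hsA : ∀ A : ℝ, ∃ m : ℝ, 0 < m ∧ ∀ win : Window, win.a ≤ A → m ≤ s win) :
    DialEscape {d : Datum | ∀ win : Window, WindowStrictlyPositive
      (d win - zetaDatum win + s win • (1 : Matrix (Fin (win.N + 1)) (Fin (win.N + 1)) ℝ))} := fun _ =>
  ⟨fun p _ => escapesBelowAlong_tube_pDial hs hsA p, escapesBelowAlong_tube_shift hs hsA⟩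

/-- **PROVED — G1-contU MEMBERSHIP CERTIFICATE** (the strictest typed class). [folklore] -/
theorem inG1contU_tube {s : Window → ℝ} (hs : ∀ win, 0 < s win)
    (hsA : ∀ A : ℝ, ∃ m : ℝ, 0 < m ∧ ∀ win : Window, win.a ≤ A → m ≤ s win) :
    InG1contU {d : Datum | ∀ win : Window, WindowStrictlyPositive
      (d win - zetaDatum win + s win • (1 : Matrix (Fin (win.N + 1)) (Fin (win.N + 1)) ℝ))} :=
  ⟨inG1cont_tube hs, dialEscape_tube hs hsA⟩

/-! ## §3 The tube rejects every single-slot arithmetic perturbation of `ζ` -/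

/-- **PROVED — SINGLE-SLOT REJECTION AT A HARMONIC WINDOW.** If `w′` agrees with `ζ`'s table off one slot `q₀ ≥ 2`
(prime or not) and differs there by `η ≠ 0`, then at a window `a = (n+1) log q₀`, `N ≥ n+1` with slack `≤ |η|` the
datum `datumOf w′` is outside the tube, whatever the sign of `η`: the difference to `ζ` is the single pattern
`−2η θ(log q₀)`, two-signed on `e_0`, `e_{n+1}` with `θ_{00} = −θ_{n+1,n+1} ≥ 1/2`. (`pDial_not_mem_tube` is the case
`w′ = dial p K ζ`.) [folklore] -/
theorem singleSlot_not_mem_tube {s : Window → ℝ} {w' : Weights} {q₀ : ℕ} (hq₀ : 2 ≤ q₀)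
    (hagree : ∀ q, q ≠ q₀ → w' q = zetaWeights q) (hne : w' q₀ ≠ zetaWeights q₀)
    {win : Window} {n : ℕ} (hwa : win.a = ((n : ℝ) + 1) * Real.log q₀) (hwN : n + 1 ≤ win.N)
    (hsw : s win ≤ |w' q₀ - zetaWeights q₀|) :
    datumOf w' ∉ {d : Datum | ∀ win : Window, WindowStrictlyPositive
      (d win - zetaDatum win + s win • (1 : Matrix (Fin (win.N + 1)) (Fin (win.N + 1)) ℝ))} := by
  intro hd
  have hlog : 0 < Real.log q₀ := Real.log_pos (by exact_mod_cast (by omega : 1 < q₀))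
  have hyle : Real.log q₀ ≤ 2 * win.a := by rw [hwa]; nlinarith
  have hmem : q₀ ∈ primeRange (2 * win.a) := mem_primeRange_of_log_le hyle
  have hiso : ∀ q ∈ primeRange (2 * win.a), q ≠ q₀ → w' q = zetaWeights q := fun q _ hq => hagree q hq
  have hform : ∀ i : Fin (win.N + 1),
      (Pi.single i 1 : Fin (win.N + 1) → ℝ) ⬝ᵥ ((datumOf w' win - zetaDatum win + s win • (1 : Matrix _ _ ℝ))
        *ᵥ Pi.single i 1)
        = -(2 * ((w' q₀ - zetaWeights q₀) * thetaEven (2 * win.a) i i (Real.log q₀))) + s win := by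
    intro i
    rw [single_form_single, Matrix.add_apply, Matrix.smul_apply, Matrix.one_apply_eq, smul_eq_mul,
      show zetaDatum = datumOf zetaWeights from rfl, datumOf_sub_apply_of_single hmem hiso]
    ring
  have hθge : 1 / 2 ≤ (2 * win.a - Real.log q₀) / (2 * win.a) := by
    rw [hwa, le_div_iff₀ (mul_pos two_pos (mul_pos (by positivity) hlog))]
    nlinarith [(Nat.cast_nonneg n : (0 : ℝ) ≤ n)]
  have hθ0 : thetaEven (2 * win.a) ((0 : Fin (win.N + 1)) : ℕ) ((0 : Fin (win.N + 1)) : ℕ) (Real.log q₀)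
      = (2 * win.a - Real.log q₀) / (2 * win.a) := by rw [Fin.val_zero, thetaEven_zero_zero_apply]
  let i : Fin (win.N + 1) := ⟨n + 1, by omega⟩
  have hθN : thetaEven (2 * win.a) (i : ℕ) (i : ℕ) (Real.log q₀) = -((2 * win.a - Real.log q₀) / (2 * win.a)) := by
    have hang := angle_harmonic hlog.ne' n
    rw [← hwa] at hang
    exact thetaEven_diag_of_angle (Nat.succ_ne_zero n) hang
  rcases lt_or_gt_of_ne (sub_ne_zero.2 hne) with hneg | hpos
  · -- `η < 0`: read mode `n+1`
    have h := hd win (Pi.single i 1) (fun h => by simpa using congrFun h i)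
    rw [hform i, hθN] at h
    have habs : |w' q₀ - zetaWeights q₀| = -(w' q₀ - zetaWeights q₀) := abs_of_neg hneg
    nlinarith
  · -- `η > 0`: read mode `0`
    have h := hd win (Pi.single 0 1) (fun h => by simpa using congrFun h 0)
    rw [hform 0, hθ0] at h
    have habs : |w' q₀ - zetaWeights q₀| = w' q₀ - zetaWeights q₀ := abs_of_pos hpos
    nlinarith

/-- **PROVED — THE TUBE REJECTS EVERY SINGLE-SLOT ARITHMETIC PERTURBATION OF `ζ`** (any slot `q₀ ≥ 2`, any nonzero
change, either sign) when the slack vanishes along heights — RH-free and sign-free; Beurling-type one-generator fakes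
and all prime dials are instances. [folklore] -/
theorem singleSlot_not_mem_tube_of_vanishing {s : Window → ℝ}
    (hs0 : ∀ ε : ℝ, 0 < ε → ∃ A : ℝ, ∀ win : Window, A ≤ win.a → s win ≤ ε)
    {w' : Weights} {q₀ : ℕ} (hq₀ : 2 ≤ q₀) (hagree : ∀ q, q ≠ q₀ → w' q = zetaWeights q)
    (hne : w' q₀ ≠ zetaWeights q₀) :
    datumOf w' ∉ {d : Datum | ∀ win : Window, WindowStrictlyPositive
      (d win - zetaDatum win + s win • (1 : Matrix (Fin (win.N + 1)) (Fin (win.N + 1)) ℝ))} := by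
  obtain ⟨A, hA⟩ := hs0 |w' q₀ - zetaWeights q₀| (abs_pos.2 (sub_ne_zero.2 hne))
  have hlog : 0 < Real.log q₀ := Real.log_pos (by exact_mod_cast (by omega : 1 < q₀))
  obtain ⟨n, hn⟩ := exists_nat_ge (A / Real.log q₀)
  have ha0 : 0 < ((n : ℝ) + 1) * Real.log q₀ := by positivity
  have hAle : A ≤ ((n : ℝ) + 1) * Real.log q₀ := by
    have := (div_le_iff₀ hlog).1 hn; nlinarith
  exact singleSlot_not_mem_tube hq₀ hagree hne (win := ⟨((n : ℝ) + 1) * Real.log q₀, n + 1, ha0⟩) rfl le_rfl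
    (hA _ hAle)

/-! ## §4 Headline -/

/-- **PROVED — ONE COUPLING CRITERION IN ALL THREE TYPED G1 CLASSES (RH-free, sign-free).** The tube with slack
`s_w = 1/(a_w + 1)` lies in `G1-cont`, in the strict class `G1-contU` and in the step stratum `G1-int`, contains `ζ`
(VACUOUSLY) and rejects every `p`-dial `K ≠ 1` (heavy or light, up or down), every down-shift and every single-slot
arithmetic perturbation of `ζ` (slot `q₀ ≥ 2`, either sign). The typed classes
constrain shape and dial behaviour only; what a member certifies about `ζ` is decided member-wise. [folklore] -/
theorem exists_mem_all_G1_classes_zeta_excluding_dials :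
    ∃ S : Set Datum, InG1cont S ∧ InG1contU S ∧ InG1int S ∧ zetaDatum ∈ S ∧
      (∀ p : ℕ, p.Prime → ∀ K : ℝ, K ≠ 1 → pDial p K ∉ S) ∧ (∀ δ : ℝ, 0 < δ → shiftDial δ ∉ S) ∧
      (∀ (w' : Weights) (q₀ : ℕ), 2 ≤ q₀ → (∀ q, q ≠ q₀ → w' q = zetaWeights q) → w' q₀ ≠ zetaWeights q₀ →
        datumOf w' ∉ S) := by
  set s : Window → ℝ := fun win => 1 / (win.a + 1) with hs
  have hspos : ∀ win, 0 < s win := fun win => by have := win.ha; rw [hs]; positivity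
  have hsA : ∀ A : ℝ, ∃ m : ℝ, 0 < m ∧ ∀ win : Window, win.a ≤ A → m ≤ s win := fun A =>
    ⟨1 / (max A 0 + 1), by positivity, fun win hwin => by
      have := win.ha
      rw [hs]
      exact one_div_le_one_div_of_le (by positivity) (by linarith [le_max_left A 0])⟩
  have hs0 : ∀ ε : ℝ, 0 < ε → ∃ A : ℝ, ∀ win : Window, A ≤ win.a → s win ≤ ε := by
    refine fun ε hε => ⟨1 / ε, fun win hwin => ?_⟩
    have ha := win.ha
    rw [hs, show (fun win : Window => 1 / (win.a + 1)) win = 1 / (win.a + 1) from rfl,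
      div_le_iff₀ (by positivity)]
    have := (div_le_iff₀ hε).1 hwin; nlinarith
  exact ⟨_, inG1cont_tube hspos, inG1contU_tube hspos hsA, inG1int_tube hspos, zeta_mem_tube hspos,
    fun p hp K hK => pDial_not_mem_tube_of_vanishing hs0 hp hK,
    fun δ hδ => shiftDial_not_mem_tube_of_vanishing hs0 hδ,
    fun w' q₀ hq₀ hagree hne => singleSlot_not_mem_tube_of_vanishing hs0 hq₀ hagree hne⟩

/-- **PROVED — NO CLASS-LEVEL WALL FOR THE TYPED G1 CLASSES WITH THE DIAL BATTERY AS SOUNDNESS CLAUSE.** The schema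
"every criterion in `G1-cont ∩ G1-contU ∩ G1-int` that contains `ζ` and rejects every `p`-dial `K ≠ 1`, every
down-shift and every single-slot arithmetic perturbation of `ζ` forces Galerkin Weil positivity of `ζ`" is EQUIVALENT
to that positivity (witness: the coupling tube). Parallel to `monotone_barrier_schema_iff`; a wall for these classes
needs a soundness clause the tube fails (e.g. `Ne`-soundness on all of `arithDialSpace`, or M-soundness). [folklore] -/
theorem g1_dialBattery_schema_iff :
    (∀ S : Set Datum, InG1cont S → InG1contU S → InG1int S → zetaDatum ∈ S →
        (∀ p : ℕ, p.Prime → ∀ K : ℝ, K ≠ 1 → pDial p K ∉ S) → (∀ δ : ℝ, 0 < δ → shiftDial δ ∉ S) →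
        (∀ (w' : Weights) (q₀ : ℕ), 2 ≤ q₀ → (∀ q, q ≠ q₀ → w' q = zetaWeights q) → w' q₀ ≠ zetaWeights q₀ →
          datumOf w' ∉ S) →
        AllWindowsPositive zetaDatum)
      ↔ AllWindowsPositive zetaDatum := by
  refine ⟨fun h => ?_, fun h _ _ _ _ _ _ _ _ => h⟩
  obtain ⟨S, h1, h2, h3, h4, h5, h6, h7⟩ := exists_mem_all_G1_classes_zeta_excluding_dials
  exact h S h1 h2 h3 h4 h5 h6 h7

end Summit.RiemannHypothesis.RiemannHypothesis.Theorems.PfPersistence
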